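import Mathlib
import HarnessLib
import Summits.ValiantsHypothesis.ValiantsHypothesis.Theses.MonotoneRestoration
import Literature.Computability.AlgebraicComplexity.ArithCircuit
import Literature.Computability.AlgebraicComplexity.ArithCircuitProofs
import Literature.Computability.AlgebraicComplexity.MonotoneStructure
import Literature.Computability.AlgebraicComplexity.PermanentIrreducible
import Literature.ModelTheory.FiniteModelTheory.CkEquiv
import Summits.ValiantsHypothesis.ValiantsHypothesis.Theorems.MonotoneRestorationMonotoneRestorationQPCosetCount
import Summits.ValiantsHypothesis.ValiantsHypothesis.Theorems.MonotoneRestorationMonotoneRestorationQPSymmetricLB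
import Summits.ValiantsHypothesis.ValiantsHypothesis.Theorems.MonotoneRestorationMonotoneRestorationQPSupportSymmetrisation
import Summits.ValiantsHypothesis.ValiantsHypothesis.Theorems.MonotoneRestorationMonotoneRestorationQPSparseRegime
import Summits.ValiantsHypothesis.ValiantsHypothesis.Theorems.MonotoneRestorationMonotoneRestorationQPBeta
import Literature.Computability.AlgebraicComplexity.SymmetricArithCircuit
import Literature.Computability.AlgebraicComplexity.DawarWilsenach2025Proofs
import Literature.GroupTheory.PermutationGroups.SmallIndexSubgroups
import Summits.ValiantsHypothesis.ValiantsHypothesis.Theorems.MonotoneRestorationQP.Negative.LoadBearing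
import Summits.ValiantsHypothesis.ValiantsHypothesis.Theorems.MonotoneRestorationMonotoneRestorationQPPermSupportCount
import Literature.Computability.AlgebraicComplexity.IMMInVPProofs

/-! TTRL-lite variant V19244 of stmt-ValiantsHypothesis-15886 -/

-- `Summit.ValiantsHypothesis.ValiantsHypothesis.…` is the tree's mandated single-conjunct layout
-- (Sub = Summit), so the duplicated namespace component is intended.
set_option linter.dupNamespace false

namespace Summit.ValiantsHypothesis.ValiantsHypothesis.Theorems

open Summit.ValiantsHypothesis.ValiantsHypothesis.Theses.MonotoneRestoration
open Literature.Computability.AlgebraicComplexity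

/-- TTRL-lite variant V19244 of `stub_esymmRowSums_complexity` (stmt-ValiantsHypothesis-15886):
the **substitution lemma** for fan-in-two circuit complexity over `ℝ≥0`,
`L(f(g₁, …, g_n)) ≤ L(f) + ∑ᵢ L(gᵢ)`. Juxtapose minimal circuits for the `gᵢ` and plug their
outputs into the inputs of a minimal circuit for `f`; this is the tree's `complexity_aeval_le`
(Bürgisser 2000, proof of Prop. 2.3 and Rem. 2.7) read through `bind₁ g = aeval g`
(`MvPolynomial.aeval_eq_bind₁`). [cite: Burgisser2000, Rem. 2.7] -/
theorem stub_esymmRowSums_complexity_var19244 :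
    ∀ (n : ℕ) (τ : Type) (g : Fin n → MvPolynomial τ NNReal) (f : MvPolynomial (Fin n) NNReal),
      complexity (MvPolynomial.bind₁ g f) ≤ complexity f + ∑ i : Fin n, complexity (g i) := by
  intro n τ g f
  rw [← MvPolynomial.aeval_eq_bind₁]
  exact complexity_aeval_le f g

end Summit.ValiantsHypothesis.ValiantsHypothesis.Theorems
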